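import Summits.QuantumAdvantage.QuantumAdvantage.Theses.SpinorFlattening
import Summits.QuantumAdvantage.QuantumAdvantage.Theorems.SpinorFlatteningNegApproxGaussRankSuperpoly
import Literature.Computability.QuantumComplexity.GaussianRank

/-!
# Crux `SpinorFlattening.FlatteningBoundRobust` (stmt-QuantumAdvantage-1246) — line `isometric-subflattening-deficit`

Crux-plan skeleton, generation 2 (planner-cruxplan-stmt-QuantumAdvantage-1246-isometric-subflatten-g2-0, 2026-08-16),
for the triage-passed idea `Cruxes/FlatteningBoundRobust/Ideas/isometric-subflattening-deficit.md` (panel r1: pass ×3,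
merged with `mass-bound-corollary` and `isometric-subflattening-bessel` — ONE line: "the crux is a corollary of the
sibling crux 1245's line `spectral-mass-flattening`").  Generation 1 (same unit, 03:03Z) published this line as a
stub-free proof; generation 2 keeps that proof verbatim and adds the REGISTERED-STUB block the crux protocol asks for,
so the line is auditable as a skeleton (registered stubs; composition `robust_of_parts` over their statements;
`FlatteningBoundRobust_of_stubs` = that composition on the stubs, sorries only inside the three declared stubs) AND
closed in-file: the audited theorem `FlatteningBoundRobust_of : SpinorFlattening.FlatteningBoundRobust` is SORRY-FREE
(the same composition with each stub replaced by the landed theorem whose statement it copies), so the skeleton audit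
reports `closed = true`.

**Status: CLOSED — every registered stub is VERBATIM a landed theorem of the tree** (close each with `exact`):

| stub (registered) | idea-card part | landed as |
|---|---|---|
| `stub_deficiency` | K1 deficiency (rank 2, hardest) | `Theorems.SpinorFlattening.deficiency` (p76218; = `stub_normalOrder` p75761 + `stub_filterCard` p74182) |
| `stub_flatOrthonormal` | K2 fullness (rank 3) | `Theorems.SpinorFlattening.flatOrthonormal` (p76218; = `stub_flatOrthoOfInvariant` p74600 + `stub_magicInvariant` p74598) |
| `stub_massBound` | P1 Bessel mass bound | `Theorems.SpinorFlattening.stub_massBound` (p71968) |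
| — (used as landed support, not a stub) | P2 lower family count `C(t,K)·8^K ≤ |𝔉_K|` | `Theorems.SpinorFlattening.countGap_choose_mul_pow_le_card` (p74656) |
| — (proved HERE, 25 lines) | P3 `C(t,K)·8^K ≤ C(8t,K)` | `choose_mul_pow_le` below |

The three stub names and statements coincide character-for-character with the sibling rendering
`Lines/isometric-subflattening-bessel.lean` (same merged line), so the crux's stub registry is the same whichever file
registered last.  For the lead: nothing to build — propose the sorry-free part of this file (drop the `## Registered
stubs` block and `FlatteningBoundRobust_of`, or simply the Theorems-ready copy attached to the item as
`SpinorFlatteningFlatteningBoundRobust.lean`, 03:00:46Z) as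
`Theorems/SpinorFlatteningFlatteningBoundRobust.lean --workitem stmt-QuantumAdvantage-1246`; item 1249
(`FlatteningBoundExact`) follows in the same file by `flatteningBoundExact_of_robust`.

## The line (Bessel mass bound on the isometric one-per-block sub-flattening; the DEFICIT form)
Fix `t, K`; `𝔉_K` = block patterns `s : Fin t → Option (Fin 4 × Bool)` exciting exactly `K` blocks, each by ONE
Jordan–Wigner Majorana; `mono s` = the ordered product (increasing blocks).  For `φ = Σ_{i<r} aᵢ gᵢ` with Gaussian `gᵢ`:
K1 gives `W ∋ mono s · φ` for all `s ∈ 𝔉_K`, `dim W ≤ r·D_K(4t)`; K2 says `(mono s · M^{⊗t})_s` is orthonormal; P1 gives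
`|𝔉_K| − dim W ≤ |𝔉_K|·‖M^{⊗t} − φ‖²`, which DESCENDS along `R := C(t,K)·8^K ≤ |𝔉_K|` (P2) to the sharp DEFICIT form
(C⁺ = the idea's Transfer = `FlatteningBoundBessel` of `Transfer.lean`)  `R − r·D_K(4t) ≤ R·‖M^{⊗t} − φ‖²`;
the crux's strict count `r·D_K(4t) < R` makes the left side `≥ 1`, and `R ≤ C(8t,K)` (P3) ends it.

## Disproof.lean used (Cruxes/FlatteningBoundRobust/Disproof.lean v4, gen 2; landed
`Theorems/FlatteningBoundRobust/Negative/{LoadBearing, DictionaryRigidity, AnnihilatorCount}.lean`)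
* `flatteningBoundRobust_iff` / `Negative.flatteningBoundRobust_iff_named`: the inline `maj/IsGauss/Mpow` lets are
  definitionally `majorana/IsGaussian/magicMPow` — `FlatteningBoundRobust_of` is accepted by `exact` on the named form.
* `_false_without_count`, `_false_with_le`: the STRICT count is consumed exactly once (`hd1 : r·D_K(4t) + 1 ≤ R` in
  `robust_of_bessel`); with `≤` the same chain only yields `0 ≤ R·normSq`.
* `_false_without_gauss`, `_false_without_linIndep`, `_false_with_four_fewer_annihilators` (Negative/AnnihilatorCount),
  `_false_with_deficiency_pred` (Negative/DictionaryRigidity): Gaussianity with `n` INDEPENDENT annihilators enters only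
  through `stub_deficiency` (inside the landed `stub_normalOrder`: `n` annihilators ⇒ `n`-letter complement ⇒ exactly
  `D_K(n)`, never `D_K(n) − 1`, never `n − 4` annihilators).
* §B (`ψ ≠ 0` not load-bearing): unused here, consistent.  §C/§H tightness (`massBound_attained_t1`,
  `not_better_than_massBound_t1`, `flatteningBoundRobust_tight_K0/_r0`, `not_without_binomial_factor_t1`): C⁺ (`bessel`)
  is ATTAINED at `(t,K,r) = (1,1,1)`; the factor `C(8t,K)` is kept.  §E Targets: none registered.  §F
  `choose_mul_eight_pow_le` = `choose_mul_pow_le` here (re-proved by structural `induction`, no equation-compiler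
  auxiliaries, so the tree-connectivity audit sees the helper).
* No stub is an instance a landed Negative lemma refutes: each stub is itself a landed theorem, and the scratch check
  `scratch-negatives.lean` (planner folder) elaborates this file's content next to the three Negative modules and derives
  `Negative.flatteningBoundRobust_imp_count_le_two_pow FlatteningBoundRobust_of` (now unconditional).
-/

set_option linter.dupNamespace false -- D-0017: single-problem summit ⇒ `QuantumAdvantage.QuantumAdvantage` by design

noncomputable section

namespace Summit.QuantumAdvantage.QuantumAdvantage.Cruxes.FlatteningBoundRobust.IsometricSubflatteningDeficit

open Matrix Finset
open Literature.Computability.QuantumComplexity Literature.Computability.Cryptography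

/-! ## Registered stubs (each VERBATIM a landed theorem; `sorry` only so that the skeleton audit registers them) -/

/-- **stub_deficiency** (K1, rank 2 — the historically hardest part) — NORMAL-ORDERING DEFICIENCY of the
Clifford-multiplication flattening on `r`-term Gaussian combinations: for Gaussian `g₁ … g_r` on `n` qubits and any
coefficients there is ONE subspace `W` with `dim W ≤ r · D_K(n)` containing `c_{p₁} ⋯ c_{p_K} (Σ aᵢ gᵢ)` for EVERY
list of `K` Majorana labels (`W` = span of the sorted complement words of length `≤ K`, parity `K`, of all `gᵢ`; CAR
normal ordering lowers each annihilator to the right where it dies on `gᵢ` or contracts).  Size M.  LANDED verbatim as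
`Summit.QuantumAdvantage.QuantumAdvantage.Theorems.SpinorFlattening.deficiency` (p76218) — `deficiency_closed` below. -/
theorem stub_deficiency :
    ∀ (n K r : ℕ) (a : Fin r → ℂ) (g : Fin r → QReg n → ℂ), (∀ i, IsGaussian (g i)) →
      ∃ W : Submodule ℂ (QReg n → ℂ), Module.finrank ℂ W ≤ r * flatteningDeficiency K n ∧
        ∀ l : List (Fin n × Bool), l.length = K →
          (l.map fun p => majorana n p.1 p.2).prod *ᵥ (∑ i, a i • g i) ∈ W := by
  sorry

/-- **stub_flatOrthonormal** (K2, rank 3) — FULLNESS: the one-Majorana-per-block monomial images of `|M⟩^{⊗t}`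
(ordered products in increasing block order, at most one of the 8 Jordan–Wigner Majoranas per 4-qubit block) are
ORTHONORMAL: unit norm by unitarity, and for two distinct block patterns a block `X⊗X⊗X⊗X` string or an in-block `Z Z`
pair — both fixing `|M⟩^{⊗t}` — commutes with one monomial and anticommutes with the other, so the Gram entry equals
its own negative.  Size M.  LANDED verbatim as
`Summit.QuantumAdvantage.QuantumAdvantage.Theorems.SpinorFlattening.flatOrthonormal` (p76218) — `flatOrthonormal_closed`. -/
theorem stub_flatOrthonormal :
    ∀ (t : ℕ) (mono : (Fin t → Option (Fin 4 × Bool)) → Matrix (QReg (t * 4)) (QReg (t * 4)) ℂ),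
      (∀ s, mono s = ((List.finRange t).filterMap fun b =>
          (s b).map fun q => majorana (t * 4) (finProdFinEquiv (b, q.1)) q.2).prod) →
      (∀ s, star (mono s *ᵥ magicMPow t) ⬝ᵥ (mono s *ᵥ magicMPow t) = 1) ∧
        ∀ s s', s ≠ s' → star (mono s *ᵥ magicMPow t) ⬝ᵥ (mono s' *ᵥ magicMPow t) = 0 := by
  sorry

/-- **stub_massBound** (P1) — BESSEL TAIL FOR A UNITARY FAMILY (the lever of the merged line): if the `U_i` are
unitary, the vectors `U_i ψ` are orthonormal and every `U_i φ` lies in a subspace `W`, then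
`|ι| − dim W ≤ |ι| · ‖ψ − φ‖²` (`‖U_i ψ − U_i φ‖ = ‖ψ − φ‖`; `‖u − w‖² ≥ 1 − ‖P_W u‖²` for `w ∈ W`;
`Σᵢ ‖P_W uᵢ‖² ≤ dim W` by Bessel).  Size S–M.  LANDED verbatim as
`Summit.QuantumAdvantage.QuantumAdvantage.Theorems.SpinorFlattening.stub_massBound` (p71968) — `massBound_closed`. -/
theorem stub_massBound :
    ∀ (n : ℕ) (ι : Type) [Fintype ι] (U : ι → Matrix (QReg n) (QReg n) ℂ) (ψ φ : QReg n → ℂ)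
      (W : Submodule ℂ (QReg n → ℂ)),
      (∀ i, U i ∈ Matrix.unitaryGroup (QReg n) ℂ) →
      (∀ i, star (U i *ᵥ ψ) ⬝ᵥ (U i *ᵥ ψ) = 1) →
      (∀ i j, i ≠ j → star (U i *ᵥ ψ) ⬝ᵥ (U j *ᵥ ψ) = 0) →
      (∀ i, U i *ᵥ φ ∈ W) →
        (Fintype.card ι : ℝ) - Module.finrank ℂ W ≤ Fintype.card ι * normSq (ψ - φ) := by
  sorry

/-! ## P3 — the binomial comparison `C(t,K)·8^K ≤ C(8t,K)` (proved) -/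

/-- Iterated Pascal: `C(n, K+1) + m·C(n, K) ≤ C(n+m, K+1)`. [folklore] -/
theorem choose_succ_add_mul_le (n K m : ℕ) :
    n.choose (K + 1) + m * n.choose K ≤ (n + m).choose (K + 1) := by
  induction m with
  | zero => simp
  | succ m ih =>
    have hmono : n.choose K ≤ (n + m).choose K := Nat.choose_le_choose K (Nat.le_add_right n m)
    have hP : (n + (m + 1)).choose (K + 1) = (n + m).choose K + (n + m).choose (K + 1) := by
      rw [← Nat.add_assoc, Nat.choose_succ_succ']
    rw [hP]
    nlinarith [ih, hmono]

/-- `C(t,K)·8^K ≤ C(8t,K)`: choosing `K` of `t` blocks and one of `8` Majoranas in each is an injection into the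
`K`-subsets of all `8t` Majorana labels. [folklore] -/
theorem choose_mul_pow_le (t K : ℕ) : t.choose K * 8 ^ K ≤ (t * 8).choose K := by
  induction t generalizing K with
  | zero => cases K <;> simp
  | succ t ih =>
    cases K with
    | zero => simp
    | succ K =>
      have ih0 := ih K
      have ih1 : t.choose (K + 1) * (8 ^ K * 8) ≤ (t * 8).choose (K + 1) := by
        rw [← pow_succ]; exact ih (K + 1)
      have hA := choose_succ_add_mul_le (t * 8) K 8
      have hmul : (t + 1) * 8 = t * 8 + 8 := by ring
      rw [hmul, Nat.choose_succ_succ', pow_succ]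
      have hsplit : (t.choose K + t.choose (K + 1)) * (8 ^ K * 8) =
          8 * (t.choose K * 8 ^ K) + t.choose (K + 1) * (8 ^ K * 8) := by ring
      rw [hsplit]
      calc 8 * (t.choose K * 8 ^ K) + t.choose (K + 1) * (8 ^ K * 8)
          ≤ 8 * (t * 8).choose K + (t * 8).choose (K + 1) :=
            Nat.add_le_add (Nat.mul_le_mul_left 8 ih0) ih1
        _ ≤ (t * 8 + 8).choose (K + 1) := by linarith [hA]

/-! ## The composition over the stub STATEMENTS (K1, K2, P1 by `type_of%`; P2 landed, P3 proved) -/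

/-- Mass-bound DESCENT (real bookkeeping): `N − d ≤ N·x` and `R ≤ N` give `R − d ≤ R·x` (split on `x ≥ 1`). [folklore] -/
theorem descent {N R d : ℕ} {x : ℝ} (hRN : R ≤ N)
    (h : (N : ℝ) - d ≤ N * x) : (R : ℝ) - d ≤ R * x := by
  have hRN' : (R : ℝ) ≤ N := by exact_mod_cast hRN
  have hd : (0 : ℝ) ≤ d := Nat.cast_nonneg d
  by_cases hx1 : 1 ≤ x
  · nlinarith
  · rw [not_le] at hx1
    nlinarith

/-- **C⁺ (the idea's Transfer, DEFICIT form `FlatteningBoundBessel`) from the three stub statements and the landed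
lower family count (P2)**: `C(t,K)·8^K − r·D_K(4t) ≤ C(t,K)·8^K · ‖M^{⊗t} − Σ aᵢ gᵢ‖²` for Gaussian `gᵢ`, with NO
count hypothesis. -/
theorem bessel_of_parts (hD : type_of% stub_deficiency) (hO : type_of% stub_flatOrthonormal)
    (hB : type_of% stub_massBound)
    (hcard : type_of% Theorems.SpinorFlattening.countGap_choose_mul_pow_le_card) :
    ∀ (t K r : ℕ) (a : Fin r → ℂ) (g : Fin r → QReg (t * 4) → ℂ), (∀ i, IsGaussian (g i)) →
      ((t.choose K * 8 ^ K : ℕ) : ℝ) - ((r * flatteningDeficiency K (t * 4) : ℕ) : ℝ)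
        ≤ ((t.choose K * 8 ^ K : ℕ) : ℝ) * normSq (magicMPow t - ∑ i, a i • g i) := by
  classical
  intro t K r a g hg
  -- the flat family: labels, monomials, index type
  let lab : (Fin t → Option (Fin 4 × Bool)) → List (Fin (t * 4) × Bool) := fun s =>
    (List.finRange t).filterMap fun b => (s b).map fun q => (finProdFinEquiv (b, q.1), q.2)
  let mono : (Fin t → Option (Fin 4 × Bool)) → Matrix (QReg (t * 4)) (QReg (t * 4)) ℂ := fun s =>
    ((List.finRange t).filterMap fun b =>
      (s b).map fun q => majorana (t * 4) (finProdFinEquiv (b, q.1)) q.2).prod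
  have hmono_lab : ∀ s, mono s = ((lab s).map fun p => majorana (t * 4) p.1 p.2).prod := by
    intro s
    simp only [mono, lab, List.map_filterMap, Option.map_map]
    rfl
  let ι : Type := {s : Fin t → Option (Fin 4 × Bool) // (univ.filter fun b => (s b).isSome).card = K}
  -- K1 deficiency: one subspace W of dimension ≤ r·D_K(4t) holds every degree-K monomial image of φ
  obtain ⟨W, hW, hmem⟩ := hD (t * 4) K r a g hg
  -- unitarity of the monomials
  have hunit : ∀ s, mono s ∈ Matrix.unitaryGroup (QReg (t * 4)) ℂ := by
    intro s
    rw [hmono_lab]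
    refine list_prod_mem ?_
    intro x hx
    obtain ⟨p, -, rfl⟩ := List.mem_map.1 hx
    exact majorana_mem_unitaryGroup _ _ _
  -- K2 fullness: orthonormality of the images of M^{⊗t}
  obtain ⟨hO1, hO2⟩ := hO t mono (fun s => rfl)
  -- P1 mass bound for the degree-K family
  have hmass := hB (t * 4) ι (fun s => mono s.1) (magicMPow t) (∑ i, a i • g i) W
    (fun s => hunit s.1) (fun s => hO1 s.1)
    (fun s s' hss' => hO2 s.1 s'.1 fun h => hss' (Subtype.ext h))
    (fun s => by
      show mono s.1 *ᵥ _ ∈ W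
      rw [hmono_lab]
      exact hmem (lab s.1) ((Theorems.SpinorFlattening.length_filterMap_labels t s.1).trans s.2))
  -- P2 lower count and the descent
  have hR : t.choose K * 8 ^ K ≤ Fintype.card ι := by convert hcard t K
  have hdesc := descent hR hmass
  have hWR : (Module.finrank ℂ W : ℝ) ≤ ((r * flatteningDeficiency K (t * 4) : ℕ) : ℝ) := by
    exact_mod_cast hW
  linarith

/-- **The crux over the named API from C⁺ and P3**: the count `r·D_K(4t) < C(t,K)·8^K` makes the left side of C⁺
at least `1`, and `C(t,K)·8^K ≤ C(8t,K)` trades the family size for the binomial factor of the crux.  This is the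
`stub_transfer` direction `C⁺ → crux` of the protocol, PROVED. -/
theorem robust_of_bessel
    (hbessel : ∀ (t K r : ℕ) (a : Fin r → ℂ) (g : Fin r → QReg (t * 4) → ℂ), (∀ i, IsGaussian (g i)) →
      ((t.choose K * 8 ^ K : ℕ) : ℝ) - ((r * flatteningDeficiency K (t * 4) : ℕ) : ℝ)
        ≤ ((t.choose K * 8 ^ K : ℕ) : ℝ) * normSq (magicMPow t - ∑ i, a i • g i))
    (hchoose : type_of% choose_mul_pow_le) :
    ∀ t K r : ℕ, r * flatteningDeficiency K (t * 4) < t.choose K * 8 ^ K →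
      ∀ (a : Fin r → ℂ) (g : Fin r → QReg (t * 4) → ℂ), (∀ i, IsGaussian (g i)) →
        (1 : ℝ) ≤ ((t * 8).choose K : ℝ) * normSq (magicMPow t - ∑ i, a i • g i) := by
  intro t K r hcount a g hg
  have h := hbessel t K r a g hg
  -- the STRICT count, used exactly once
  have hd1 : ((r * flatteningDeficiency K (t * 4) : ℕ) : ℝ) + 1 ≤ ((t.choose K * 8 ^ K : ℕ) : ℝ) := by
    exact_mod_cast hcount
  have hC : ((t.choose K * 8 ^ K : ℕ) : ℝ) ≤ ((t * 8).choose K : ℝ) := by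
    exact_mod_cast hchoose t K
  have hnn : 0 ≤ normSq (magicMPow t - ∑ i, a i • g i) :=
    Finset.sum_nonneg fun _ _ => by positivity
  calc (1 : ℝ) ≤ ((t.choose K * 8 ^ K : ℕ) : ℝ) * normSq (magicMPow t - ∑ i, a i • g i) := by linarith
    _ ≤ ((t * 8).choose K : ℝ) * normSq (magicMPow t - ∑ i, a i • g i) :=
        mul_le_mul_of_nonneg_right hC hnn

/-- **Composition over the three stub STATEMENTS** (P2 landed, P3 proved), sorry-free: the crux in its named-API
form `∀ t K r, r·D_K(4t) < C(t,K)·8^K → ∀ a g Gaussian, 1 ≤ C(8t,K)·normSq(M^{⊗t} − Σ aᵢ gᵢ)` — definitionally the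
route decl (`Disproof.flatteningBoundRobust_iff : … := Iff.rfl`), deliberately NOT spelled with the route constant so
that `FlatteningBoundRobust_of` below is the only theorem the skeleton audit can pick. -/
theorem robust_of_parts (hD : type_of% stub_deficiency) (hO : type_of% stub_flatOrthonormal)
    (hB : type_of% stub_massBound) :
    ∀ t K r : ℕ, r * flatteningDeficiency K (t * 4) < t.choose K * 8 ^ K →
      ∀ (a : Fin r → ℂ) (g : Fin r → QReg (t * 4) → ℂ), (∀ i, IsGaussian (g i)) →
        (1 : ℝ) ≤ ((t * 8).choose K : ℝ) * normSq (magicMPow t - ∑ i, a i • g i) :=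
  robust_of_bessel (bessel_of_parts hD hO hB Theorems.SpinorFlattening.countGap_choose_mul_pow_le_card)
    choose_mul_pow_le

/-- **The skeleton instantiated on the REGISTERED stubs** (its only `sorryAx` uses are the three declared stubs):
the crux statement over the named API.  Discharging the stubs = replacing them by
`deficiency_closed`/`flatOrthonormal_closed`/`massBound_closed`, which is `FlatteningBoundRobust_of` below. -/
theorem FlatteningBoundRobust_of_stubs :
    ∀ t K r : ℕ, r * flatteningDeficiency K (t * 4) < t.choose K * 8 ^ K →
      ∀ (a : Fin r → ℂ) (g : Fin r → QReg (t * 4) → ℂ), (∀ i, IsGaussian (g i)) →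
        (1 : ℝ) ≤ ((t * 8).choose K : ℝ) * normSq (magicMPow t - ∑ i, a i • g i) :=
  robust_of_parts stub_deficiency stub_flatOrthonormal stub_massBound

/-- The same term closes the ROUTE DECL by name (definitional unfolding of the inline lets) — shown as an `example`
so that the audited theorem of this file stays unique. -/
example : Summit.QuantumAdvantage.QuantumAdvantage.Theses.SpinorFlattening.FlatteningBoundRobust :=
  robust_of_parts stub_deficiency stub_flatOrthonormal stub_massBound

/-! ## Closure (sorry-free): every stub is already a theorem of the tree, so the skeleton closes -/

/-- `stub_deficiency` DISCHARGED: it is the landed `Theorems.SpinorFlattening.deficiency` (p76218). -/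
theorem deficiency_closed : type_of% stub_deficiency :=
  Theorems.SpinorFlattening.deficiency

/-- `stub_flatOrthonormal` DISCHARGED: it is the landed `Theorems.SpinorFlattening.flatOrthonormal` (p76218). -/
theorem flatOrthonormal_closed : type_of% stub_flatOrthonormal :=
  Theorems.SpinorFlattening.flatOrthonormal

/-- `stub_massBound` DISCHARGED: it is the landed `Theorems.SpinorFlattening.stub_massBound` (p71968). -/
theorem massBound_closed : type_of% stub_massBound :=
  Theorems.SpinorFlattening.stub_massBound

/-- **C⁺ = `FlatteningBoundBessel`** (the DEFICIT inequality), hypothesis-free and sorry-free: the sharp mass form of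
the flattening bound (attained at `(t,K,r) = (1,1,1)`, Disproof §C), from the three closed stubs and the landed P2. -/
theorem bessel :
    ∀ (t K r : ℕ) (a : Fin r → ℂ) (g : Fin r → QReg (t * 4) → ℂ), (∀ i, IsGaussian (g i)) →
      ((t.choose K * 8 ^ K : ℕ) : ℝ) - ((r * flatteningDeficiency K (t * 4) : ℕ) : ℝ)
        ≤ ((t.choose K * 8 ^ K : ℕ) : ℝ) * normSq (magicMPow t - ∑ i, a i • g i) :=
  bessel_of_parts deficiency_closed flatOrthonormal_closed massBound_closed
    Theorems.SpinorFlattening.countGap_choose_mul_pow_le_card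

/-- **THE AUDITED THEOREM — the crux `SpinorFlattening.FlatteningBoundRobust` (stmt-QuantumAdvantage-1246) BY NAME,
SORRY-FREE**: from C⁺ (`bessel`) and P3, i.e. the skeleton composition with each stub replaced by the landed theorem
whose statement it copies verbatim (axioms {propext, Classical.choice, Quot.sound}).  The route's inline
`maj`/`IsGauss`/`Mpow`/count lets are definitionally `majorana`/`IsGaussian`/`magicMPow`/`flatteningDeficiency`, so the
named-API term is accepted by unfolding.  This is what the lead proposes `--workitem stmt-QuantumAdvantage-1246`. -/
theorem FlatteningBoundRobust_of :
    Summit.QuantumAdvantage.QuantumAdvantage.Theses.SpinorFlattening.FlatteningBoundRobust :=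
  robust_of_bessel bessel choose_mul_pow_le

/-- **Support item `SpinorFlattening.FlatteningBoundExact` (stmt-QuantumAdvantage-1249) from the crux** — the `δ = 0`
core: an exact `r`-term Gaussian decomposition would give `normSq 0 = 0`, contradicting `1 ≤ C(8t,K)·0`. -/
theorem flatteningBoundExact_of_robust
    (h : Summit.QuantumAdvantage.QuantumAdvantage.Theses.SpinorFlattening.FlatteningBoundRobust) :
    Summit.QuantumAdvantage.QuantumAdvantage.Theses.SpinorFlattening.FlatteningBoundExact := by
  intro t K r hcount a g hg heq
  have key : (1 : ℝ) ≤ ((t * 8).choose K : ℝ) * normSq (magicMPow t - ∑ i, a i • g i) :=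
    h t K r hcount a g hg
  have h0 : normSq (magicMPow t - ∑ i, a i • g i) = 0 := by
    have : magicMPow t = ∑ i, a i • g i := heq
    rw [this, sub_self]
    simp [normSq]
  rw [h0, mul_zero] at key
  exact absurd key (by norm_num)

/-- Item 1249 outright (sorry-free). -/
theorem flatteningBoundExact_closed :
    Summit.QuantumAdvantage.QuantumAdvantage.Theses.SpinorFlattening.FlatteningBoundExact :=
  flatteningBoundExact_of_robust FlatteningBoundRobust_of

end Summit.QuantumAdvantage.QuantumAdvantage.Cruxes.FlatteningBoundRobust.IsometricSubflatteningDeficit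

end
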